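import Summits.HubbardSuperconductivity.HubbardSuperconductivity.Theorems.AnisotropyChordTransferFibre3Lam2Small
import Summits.HubbardSuperconductivity.HubbardSuperconductivity.Theorems.AnisotropyChordTransferFibre3ShellWeight

/-!
# Route `AnisotropyChord` / H0 rotor rung: the a-priori LOWER bound on `η_eff` (two-sided `η_eff = Θ(1/ln L)`)

Companion of `…Fibre3Lam2LogBound`/`…GresZeroLower`/`…Lam2Small` (upper bounds `η_eff ≤ π²/(4H_N)`): from the exact identity
`1/η_eff = 4G̃_{λ₂}(0) + 4Δ/(4(1−Δ)+Δλ₂)` (`inv_etaEff_eq`) and UPPER bounds on the Green's function at the origin,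
* `gres_le_ratio`, `Gres_zero_zero_le_ratio`: `G̃_λ(0) ≤ G̃₀(0)·2ε₁/(2ε₁ − λ)` for `0 ≤ λ < 2ε₁` (termwise, `ε(k) ≥ ε₁`);
* `Gres_zero_zero_le_harmonic`: `G̃₀(0) ≤ H_{L/2}/2` (Jordan `2ε(k) ≥ 16|m|²/L²` via p2's `jordanEpsLower_holds`, the representative
  map `rep_injective`/`rep_mem_box`, and p2's ring count `sum_inv_normSq_le_harmonic` `≤ 8H`);
* ★★ `etaEff_ge`: **`η_eff ≥ 1/((8/3)·H_{L/2} + Δ/(1−Δ))`** for the ground profile (`L ≥ 5`, `0 ≤ Δ < 1`) — with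
  `etaEff_le_harmonic` the two-sided a-priori law `η_eff = Θ(1/ln L)` at fixed `Δ < 1`, every `L`.
Prover seat `hubbard-h0-rotor-p1` g24; helper for stmt-HubbardSuperconductivity-19089 (`--supports`).
-/

set_option linter.dupNamespace false
set_option autoImplicit false

noncomputable section

open scoped BigOperators
open Complex

namespace Summit.HubbardSuperconductivity.HubbardSuperconductivity.Theorems.AnisotropyChord.Transfer.Fibre3

variable (L : ℕ) [NeZero L]

/-! ## `G̃_λ(0)` against `G̃₀(0)` -/

/-- termwise: `g_λ(k) ≤ g₀(k)·2ε₁/(2ε₁ − λ)` for `0 ≤ λ < 2ε₁` (`L ≥ 2`). [folklore] -/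
theorem gres_le_ratio (hL : 2 ≤ L) {lam2 : ℝ} (h0 : 0 ≤ lam2) (hlam : lam2 < 2 * eps1 L) (k : Tor L) :
    gres L lam2 k ≤ gres L 0 k * (2 * eps1 L / (2 * eps1 L - lam2)) := by
  unfold gres
  by_cases hk : k = 0
  · simp [hk]
  · rw [if_neg hk, if_neg hk, sub_zero]
    have hε := eps1_le_epsT L hL hk
    have hε1 := RateLemma.eps1_pos_of_two_le L hL
    have ha : 0 < 2 * epsT L k - lam2 := by linarith
    have hb : 0 < 2 * eps1 L - lam2 := by linarith
    have hc : 0 < 2 * epsT L k := by linarith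
    rw [div_mul_div_comm, one_mul, div_le_div_iff₀ ha (mul_pos hc hb)]
    nlinarith

/-- ★ `G̃_λ(0) ≤ G̃₀(0)·2ε₁/(2ε₁ − λ)` for `0 ≤ λ < 2ε₁` (`L ≥ 2`). [folklore] -/
theorem Gres_zero_zero_le_ratio (hL : 2 ≤ L) {lam2 : ℝ} (h0 : 0 ≤ lam2) (hlam : lam2 < 2 * eps1 L) :
    Gres L lam2 0 ≤ Gres L 0 0 * (2 * eps1 L / (2 * eps1 L - lam2)) := by
  rw [Gres_zero_eq, Gres_zero_eq, div_mul_eq_mul_div, Finset.sum_mul]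
  have hV : (0 : ℝ) < (L : ℝ) ^ 2 := by
    have : (0 : ℝ) < L := by exact_mod_cast (show 0 < L by omega)
    positivity
  exact div_le_div_of_nonneg_right (Finset.sum_le_sum fun k _ => gres_le_ratio L hL h0 hlam k) hV.le

/-! ## `G̃₀(0) ≤ H_{L/2}/2` -/

/-- Jordan termwise: `g₀(k) ≤ L²/(16|m|²)` on the representative `m = (valMinAbs k₁, valMinAbs k₂)` (and `0` at `k = 0`). [folklore] -/
theorem gres_zero_le_rep (hL : 2 ≤ L) (k : Tor L) :
    gres L 0 k ≤ (L : ℝ) ^ 2 / 16 * (1 / ((((k.1.valMinAbs ^ 2 + k.2.valMinAbs ^ 2 : ℤ)) : ℝ))) := by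
  unfold gres
  by_cases hk : k = 0
  · rw [if_pos hk, hk]
    simp
  · rw [if_neg hk, sub_zero]
    have hJ := RateLemma.jordanEpsLower_holds L k
    have hε := eps1_le_epsT L hL hk
    have hε1 := RateLemma.eps1_pos_of_two_le L hL
    have hLpos : (0 : ℝ) < L := by exact_mod_cast (show 0 < L by omega)
    -- the representative is nonzero
    have hm : (0 : ℝ) < (((k.1.valMinAbs ^ 2 + k.2.valMinAbs ^ 2 : ℤ)) : ℝ) := by
      have : 0 < k.1.valMinAbs ^ 2 + k.2.valMinAbs ^ 2 := by
        by_contra hc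
        have hc' : k.1.valMinAbs ^ 2 + k.2.valMinAbs ^ 2 ≤ 0 := le_of_not_gt hc
        have h1 : k.1.valMinAbs = 0 := by nlinarith [sq_nonneg k.1.valMinAbs, sq_nonneg k.2.valMinAbs]
        have h2 : k.2.valMinAbs = 0 := by nlinarith [sq_nonneg k.1.valMinAbs, sq_nonneg k.2.valMinAbs]
        rw [ZMod.valMinAbs_eq_zero] at h1 h2
        exact hk (Prod.ext h1 h2)
      exact_mod_cast this
    have hpi : 0 < Real.pi ^ 2 := by positivity
    -- Jordan: `2ε(k) ≥ 16|m|²/L²`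
    have hJ' : 16 / (L : ℝ) ^ 2 * (((k.1.valMinAbs ^ 2 + k.2.valMinAbs ^ 2 : ℤ)) : ℝ) ≤ 2 * epsT L k := by
      push_cast at hJ ⊢
      have e : 2 / Real.pi ^ 2 * (2 * Real.pi / L) ^ 2 = 8 / (L : ℝ) ^ 2 := by
        field_simp
        ring
      rw [e] at hJ
      have e2 : 16 / (L : ℝ) ^ 2 * (((k.1.valMinAbs : ℤ) : ℝ) ^ 2 + ((k.2.valMinAbs : ℤ) : ℝ) ^ 2)
          = 2 * (8 / (L : ℝ) ^ 2 * (((k.1.valMinAbs : ℤ) : ℝ) ^ 2 + ((k.2.valMinAbs : ℤ) : ℝ) ^ 2)) := by ring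
      rw [e2]
      linarith
    calc 1 / (2 * epsT L k) ≤ 1 / (16 / (L : ℝ) ^ 2 * (((k.1.valMinAbs ^ 2 + k.2.valMinAbs ^ 2 : ℤ)) : ℝ)) :=
          one_div_le_one_div_of_le (by positivity) hJ'
      _ = (L : ℝ) ^ 2 / 16 * (1 / ((((k.1.valMinAbs ^ 2 + k.2.valMinAbs ^ 2 : ℤ)) : ℝ))) := by
          field_simp

open RateLemma in
/-- the representative sum is dominated by the punctured box `|m|∞ ≤ L/2`:
`Σ_k 1/|m(k)|² ≤ Σ_{0<|m|∞≤L/2} 1/|m|²` (the `k = 0` term reads `1/0 = 0`). [folklore] -/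
theorem sum_rep_le_box :
    ∑ k : Tor L, (1 : ℝ) / ((((k.1.valMinAbs ^ 2 + k.2.valMinAbs ^ 2 : ℤ)) : ℝ))
      ≤ ∑ m ∈ puncturedBox (L / 2), 1 / (((m.1 ^ 2 + m.2 ^ 2 : ℤ)) : ℝ) := by
  classical
  set rep : Tor L → ℤ × ℤ := fun k => (k.1.valMinAbs, k.2.valMinAbs) with hrep
  have hinj : Set.InjOn rep (Finset.univ.erase (0 : Tor L) : Finset (Tor L)) := fun a _ b _ h => rep_injective L h
  -- drop the `k = 0` term (it is `0`)
  have h0 : (1 : ℝ) / (((((0 : Tor L).1.valMinAbs ^ 2 + (0 : Tor L).2.valMinAbs ^ 2 : ℤ)) : ℝ)) = 0 := by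
    simp
  rw [← Finset.add_sum_erase Finset.univ _ (Finset.mem_univ (0 : Tor L)), h0, zero_add]
  have himg : ∑ k ∈ Finset.univ.erase (0 : Tor L), (1 : ℝ) / ((((k.1.valMinAbs ^ 2 + k.2.valMinAbs ^ 2 : ℤ)) : ℝ))
      = ∑ m ∈ (Finset.univ.erase (0 : Tor L)).image rep, 1 / (((m.1 ^ 2 + m.2 ^ 2 : ℤ)) : ℝ) := by
    rw [Finset.sum_image hinj]
  rw [himg]
  apply Finset.sum_le_sum_of_subset_of_nonneg
  · intro m hm
    rw [Finset.mem_image] at hm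
    obtain ⟨k, hk, rfl⟩ := hm
    have hk0 : k ≠ 0 := Finset.ne_of_mem_erase hk
    have hbox := rep_mem_box L k
    unfold puncturedBox
    rw [Finset.mem_erase]
    refine ⟨?_, hbox⟩
    intro h
    apply hk0
    simp only [hrep, Prod.mk.injEq, ZMod.valMinAbs_eq_zero] at h
    exact Prod.ext h.1 h.2
  · intro m _ _
    positivity

/-- ★ `G̃₀(0) ≤ H_{L/2}/2` (`L ≥ 2`). [folklore] -/
theorem Gres_zero_zero_le_harmonic (hL : 2 ≤ L) : Gres L 0 0 ≤ (harmonic (L / 2) : ℝ) / 2 := by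
  rw [Gres_zero_eq]
  have hV : (0 : ℝ) < (L : ℝ) ^ 2 := by
    have : (0 : ℝ) < L := by exact_mod_cast (show 0 < L by omega)
    positivity
  have h1 : ∑ k : Tor L, gres L 0 k
      ≤ (L : ℝ) ^ 2 / 16 * ∑ k : Tor L, (1 : ℝ) / ((((k.1.valMinAbs ^ 2 + k.2.valMinAbs ^ 2 : ℤ)) : ℝ)) := by
    rw [Finset.mul_sum]
    exact Finset.sum_le_sum fun k _ => gres_zero_le_rep L hL k
  have h2 := sum_rep_le_box L
  have h3 := RateLemma.sum_inv_normSq_le_harmonic (L / 2)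
  rw [div_le_iff₀ hV]
  have h4 : (L : ℝ) ^ 2 / 16 * ∑ k : Tor L, (1 : ℝ) / ((((k.1.valMinAbs ^ 2 + k.2.valMinAbs ^ 2 : ℤ)) : ℝ))
      ≤ (L : ℝ) ^ 2 / 16 * (8 * (harmonic (L / 2) : ℝ)) :=
    mul_le_mul_of_nonneg_left (h2.trans h3) (by positivity)
  calc ∑ k : Tor L, gres L 0 k ≤ (L : ℝ) ^ 2 / 16 * (8 * (harmonic (L / 2) : ℝ)) := h1.trans h4
    _ = (harmonic (L / 2) : ℝ) / 2 * (L : ℝ) ^ 2 := by ring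

/-! ## The lower bound on `η_eff` -/

/-- ★★ **`η_eff ≥ 1/((8/3)·H_{L/2} + Δ/(1−Δ))`** for the ground two-magnon profile (`L ≥ 5`, `0 ≤ Δ < 1`). [folklore] -/
theorem etaEff_ge (hL : 5 ≤ L) {Δ lam2 : ℝ} (hΔ0 : 0 ≤ Δ) (hΔ1 : Δ < 1) {f : Tor L → ℝ}
    (hf : IsGroundTwoMagnon L Δ lam2 f) :
    1 / (8 / 3 * (harmonic (L / 2) : ℝ) + Δ / (1 - Δ)) ≤ etaEff L lam2 := by
  have hpos := lam2_pos L (by omega) hΔ1 hf.1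
  have h2l := two_lam2_lt_eps1 L hL hΔ0 hf
  have hlt := lam2_lt_two_eps1 L hL hΔ0 hf
  have hε1 := RateLemma.eps1_pos_of_two_le L (by omega)
  have hid := inv_etaEff_eq L hL hΔ0 hΔ1 hf
  have hGlam := Gres_zero_zero_le_ratio L (by omega) hpos.le hlt
  have hG0 := Gres_zero_zero_le_harmonic L (by omega)
  have hG0pos := Gres_zero_zero_pos L (by omega)
  have hη : 0 < etaEff L lam2 := by
    unfold etaEff
    have : (0 : ℝ) < L := by exact_mod_cast (show 0 < L by omega)
    positivity
  -- the ratio `2ε₁/(2ε₁ − λ₂) ≤ 4/3`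
  have hratio : 2 * eps1 L / (2 * eps1 L - lam2) ≤ 4 / 3 := by
    rw [div_le_div_iff₀ (by linarith) (by norm_num)]
    linarith
  have hG : Gres L lam2 0 ≤ 2 / 3 * (harmonic (L / 2) : ℝ) := by
    calc Gres L lam2 0 ≤ Gres L 0 0 * (2 * eps1 L / (2 * eps1 L - lam2)) := hGlam
      _ ≤ ((harmonic (L / 2) : ℝ) / 2) * (4 / 3) :=
          mul_le_mul hG0 hratio (div_nonneg (by linarith) (by linarith)) (hG0pos.le.trans hG0)
      _ = 2 / 3 * (harmonic (L / 2) : ℝ) := by ring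
  -- the `Δ` term: `4Δ/(4(1−Δ) + Δλ₂) ≤ Δ/(1−Δ)`
  have hden : 0 < 4 * (1 - Δ) + Δ * lam2 := by nlinarith
  have hD : 4 * Δ / (4 * (1 - Δ) + Δ * lam2) ≤ Δ / (1 - Δ) := by
    rw [div_le_div_iff₀ hden (by linarith)]
    nlinarith [mul_nonneg hΔ0 hpos.le]
  have hX : 0 < 8 / 3 * (harmonic (L / 2) : ℝ) + Δ / (1 - Δ) := by
    have hH : Gres L lam2 0 ≤ 2 / 3 * (harmonic (L / 2) : ℝ) := hG
    have hGl : 0 < Gres L lam2 0 := lt_of_lt_of_le hG0pos (Gres_zero_zero_mono L (by omega) hpos.le hlt)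
    have : 0 ≤ Δ / (1 - Δ) := div_nonneg hΔ0 (by linarith)
    nlinarith
  -- `1/η = 4G̃_{λ₂}(0) + 4Δ/(…) ≤ (8/3)H + Δ/(1−Δ)`
  have hinv : 1 / etaEff L lam2 ≤ 8 / 3 * (harmonic (L / 2) : ℝ) + Δ / (1 - Δ) := by
    rw [hid]; linarith
  rw [div_le_iff₀ hη] at hinv
  rw [div_le_iff₀ hX]
  linarith

end Summit.HubbardSuperconductivity.HubbardSuperconductivity.Theorems.AnisotropyChord.Transfer.Fibre3

end
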